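import Literature.MathematicalPhysics.QuantumLattice.HubbardGridScaleCovariances
import Literature.MathematicalPhysics.QuantumLattice.HubbardGridTrackedNorms
import Literature.MathematicalPhysics.QuantumLattice.GrassmannFlowDBRefined
import Mathlib.Analysis.Complex.ExponentialBounds
import HarnessLib

/-!
# The parameters of the multiscale flow of the Hubbard torus at `βU ≤ κ`: ratio, field radii, tracked couplings, and the size of the
# tracked part at each scale

Topic `MathematicalPhysics/QuantumLattice`; cell gate-hubbard-kl, R0-SCOPE-4 W7 (the data half of the closure of
`GrassmannFlowDBRefined.iterEffAction_splitFlow_geometric_refined_of_gramBounded` for the covariances `C_j` of `HubbardGridScaleCovariances`).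
Fixed numerics: field-radius ratio `s = 1` (`ρ_j = κ_j`), scale ratio `r = 64e¹⁰` (`√r = 8e⁵`), contraction parameter
`x̄ = e²(κ_j+ρ_j)t_j = 2e²/√r = 1/(4e³)`, `g = x̄²/(1-x̄²)`, `ε = 1/30`; the only inequality between them that the closure uses is
`(11/10)·e·g·√r ≤ 3/5` (`flow_numeric_key`: the per-step growth `e g r^{5/2}(1+3ε)` of the pollution is below `(3/5) r²`, while the
source decays like `β⁻¹ r^{K-j}` and `r^{K-1} ≤ Λ₀β/π` — Benfatto–Giuliani–Mastropietro 2006, §2.8: the inductive bounds close because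
the dimensional gain per scale beats the combinatorial loss).  The sequences: `flowKap` (`κ_0 = κ₀`, `κ_j = √(A Λ_j)`, `1` beyond `K`),
`flowRho` (`ρ_0 = √r κ_1`, `ρ_j = κ_j`), `flowT` (`t_0 = x̄/(e²(κ_0+ρ_0))`, `t_{j+1} = 1/ρ_j`), the tracked couplings
`ν_j = ν₀ + u Σ_{i<j} t_i` (`flowNu`), the pinned norms `flowNL = gridTrackedNL` and their field-weighted size `flowLam = normV`,
computed in closed form (`flowLam_eq`), and the bounds `|ν_j| ≤ |u| Λ_j (1 + 2A)` (`norm_flowNu_le`, from `|t_i| ≤ κ_i²` and a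
residual hypothesis `|ν₀ + u Σ_{i ≤ K} t_i| ≤ |u| π/β`) and `Λn_j ≤ E₁ |u| Λ_j² β/N` (`flowLam_le`).

Everything is proved; the listed functions and numerals are the only definitions; no named facts.

## Sources

G. Benfatto, A. Giuliani, V. Mastropietro, Ann. Henri Poincaré 7 (2006) 809–898, §2.8 (2.80)–(2.88) (`BenfattoGiulianiMastropietro2006`).
-/

noncomputable section

namespace Literature.MathematicalPhysics.QuantumLattice

open Literature.Probability.LatticeModels GrassmannAlgebra Finset Complex

/-! ### The fixed numerics -/

/-- `√r = 8e⁵`. [cite: BenfattoGiulianiMastropietro2006, §2.8 (2.88)] -/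
def flowSqr : ℝ := 8 * Real.exp 5

/-- The scale ratio `r = 64e¹⁰`. [cite: BenfattoGiulianiMastropietro2006, §2.8 (2.88)] -/
def flowR : ℝ := flowSqr ^ 2

/-- The contraction parameter `x̄ = 1/(4e³)` (`= 2e²/√r`). [cite: BenfattoGiulianiMastropietro2006, §2.8 (2.88)] -/
def flowX : ℝ := 1 / (4 * Real.exp 3)

/-- `g = x̄²/(1-x̄²)`. [cite: BenfattoGiulianiMastropietro2006, §2.8 (2.88)] -/
def flowG : ℝ := flowX ^ 2 / (1 - flowX ^ 2)

/-- `ε = 1/30`, the ceiling of every `θ_j`. [cite: BenfattoGiulianiMastropietro2006, §2.8 (2.88)] -/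
def flowEps : ℝ := 1 / 30

/-- `0 < √r`. [cite: BenfattoGiulianiMastropietro2006, §2.8 (2.88)] -/
theorem flowSqr_pos : 0 < flowSqr := by unfold flowSqr; positivity

/-- `r = (√r)²`, `0 < r`, `2 ≤ r`. [cite: BenfattoGiulianiMastropietro2006, §2.8 (2.88)] -/
theorem two_le_flowR : 2 ≤ flowR := by
  unfold flowR flowSqr
  have : (1 : ℝ) ≤ Real.exp 5 := Real.one_le_exp (by norm_num)
  nlinarith

/-- `0 < r`. [cite: BenfattoGiulianiMastropietro2006, §2.8 (2.88)] -/
theorem flowR_pos : 0 < flowR := lt_of_lt_of_le (by norm_num) two_le_flowR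

/-- `√(flowR) = flowSqr`. [cite: BenfattoGiulianiMastropietro2006, §2.8 (2.88)] -/
theorem sqrt_flowR : Real.sqrt flowR = flowSqr := by rw [flowR, Real.sqrt_sq flowSqr_pos.le]

/-- `x̄ = 2e²/√r`. [cite: BenfattoGiulianiMastropietro2006, §2.8 (2.88)] -/
theorem flowX_eq : flowX = 2 * Real.exp 2 / flowSqr := by
  unfold flowX flowSqr
  rw [show (5 : ℝ) = 2 + 3 by norm_num, Real.exp_add]
  have h2 : 0 < Real.exp 2 := Real.exp_pos 2
  field_simp
  ring

/-- `0 < x̄ < 1/80`. [cite: BenfattoGiulianiMastropietro2006, §2.8 (2.88)] -/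
theorem flowX_pos : 0 < flowX := by unfold flowX; positivity

/-- `x̄ ≤ 1/80` (`e³ > 20`). [cite: BenfattoGiulianiMastropietro2006, §2.8 (2.88)] -/
theorem flowX_le : flowX ≤ 1 / 80 := by
  unfold flowX
  have h1 := Real.exp_one_gt_d9
  have h3 : (20 : ℝ) ≤ Real.exp 3 := by
    rw [show (3 : ℝ) = 1 + 1 + 1 by norm_num, Real.exp_add, Real.exp_add]
    nlinarith [mul_pos (mul_pos (Real.exp_pos 1) (Real.exp_pos 1)) (Real.exp_pos 1), Real.exp_pos (1:ℝ)]
  rw [div_le_div_iff₀ (by positivity) (by norm_num)]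
  linarith

/-- `x̄² < 1`. [cite: BenfattoGiulianiMastropietro2006, §2.8 (2.88)] -/
theorem flowX_sq_lt_one : flowX ^ 2 < 1 := by nlinarith [flowX_pos, flowX_le]

/-- `0 < g`. [cite: BenfattoGiulianiMastropietro2006, §2.8 (2.88)] -/
theorem flowG_pos : 0 < flowG := by
  unfold flowG; exact div_pos (pow_pos flowX_pos 2) (by linarith [flowX_sq_lt_one])

/-- `0 < ε < 1`. [cite: BenfattoGiulianiMastropietro2006, §2.8 (2.88)] -/
theorem flowEps_pos : 0 < flowEps := by unfold flowEps; norm_num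

/-- `ε < 1`. [cite: BenfattoGiulianiMastropietro2006, §2.8 (2.88)] -/
theorem flowEps_lt_one : flowEps < 1 := by unfold flowEps; norm_num

/-- **The key numeric inequality**: `(11/10)·e·g·√r ≤ 3/5` (so the per-step growth `e g r^{5/2}(1+3ε)` is `≤ (3/5) r²`).
[cite: BenfattoGiulianiMastropietro2006, §2.8 (2.88)] -/
theorem flow_numeric_key : 11 / 10 * Real.exp 1 * flowG * flowSqr ≤ 3 / 5 := by
  -- `e·x̄²·√r = e·8e⁵/(16e⁶) = 1/2` exactly, and `1/(1-x̄²) ≤ 12/11`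
  have hx2 : flowX ^ 2 = 1 / (16 * Real.exp 6) := by
    unfold flowX; rw [show (6 : ℝ) = 3 + 3 by norm_num, Real.exp_add]; field_simp; ring
  have hexact : Real.exp 1 * flowX ^ 2 * flowSqr = 1 / 2 := by
    rw [hx2, flowSqr, show (6 : ℝ) = 1 + 5 by norm_num, Real.exp_add]
    have := Real.exp_pos (1 : ℝ); have := Real.exp_pos (5 : ℝ)
    field_simp; ring
  have hden : 11 / 12 ≤ 1 - flowX ^ 2 := by nlinarith [flowX_pos, flowX_le]
  unfold flowG
  rw [show 11 / 10 * Real.exp 1 * (flowX ^ 2 / (1 - flowX ^ 2)) * flowSqr = 11 / 10 * (Real.exp 1 * flowX ^ 2 * flowSqr) / (1 - flowX ^ 2) by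
    ring, hexact, div_le_iff₀ (by linarith)]
  linarith

/-- `(11/10) e g r^{5/2} ≤ (3/5) r²` in the form used by the budget: `e·g·√r·r²·(11/10) ≤ (3/5)·r²`. [cite: BenfattoGiulianiMastropietro2006, §2.8 (2.88)] -/
theorem flow_growth_le : 11 / 10 * (Real.exp 1 * flowG * (flowSqr * flowR ^ 2)) ≤ 3 / 5 * flowR ^ 2 := by
  have := mul_le_mul_of_nonneg_right flow_numeric_key (pow_nonneg flowR_pos.le 2)
  linarith

/-! ### The sequences -/

section Sequences

variable (A κ₀ β Λ₀ : ℝ) (K : ℕ)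

/-- **The Gram constants** `κ_0 = κ₀`, `κ_j = √(A Λ_j)` (`1 ≤ j ≤ K`), `1` beyond. [cite: BenfattoGiulianiMastropietro2006, §2.8 (2.80)] -/
def flowKap (j : ℕ) : ℝ := if j = 0 then κ₀ else if j ≤ K then Real.sqrt (A * gridScale β Λ₀ flowR K j) else 1

/-- **The field radii** `ρ_0 = √r κ_1`, `ρ_j = κ_j` (`j ≥ 1`). [cite: BenfattoGiulianiMastropietro2006, §2.8 (2.85)] -/
def flowRho (j : ℕ) : ℝ := if j = 0 then flowSqr * flowKap A κ₀ β Λ₀ K 1 else flowKap A κ₀ β Λ₀ K j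

/-- **The deviation weights** `t_0 = x̄/(e²(κ_0+ρ_0))`, `t_{j+1} = 1/ρ_j`. [cite: BenfattoGiulianiMastropietro2006, §2.8 (2.85)] -/
def flowT (j : ℕ) : ℝ :=
  if j = 0 then flowX / (Real.exp 2 * (flowKap A κ₀ β Λ₀ K 0 + flowRho A κ₀ β Λ₀ K 0)) else (flowRho A κ₀ β Λ₀ K (j - 1))⁻¹

variable {A κ₀ β Λ₀ K}

/-- `κ_j > 0` (`A, κ₀, β > 0`). [cite: BenfattoGiulianiMastropietro2006, §2.8 (2.80)] -/
theorem flowKap_pos (hA : 0 < A) (hκ₀ : 0 < κ₀) (hβ : 0 < β) (j : ℕ) : 0 < flowKap A κ₀ β Λ₀ K j := by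
  unfold flowKap
  split_ifs with h0 hj
  · exact hκ₀
  · refine Real.sqrt_pos.2 (mul_pos hA ?_)
    rw [gridScale_of_ne_zero β Λ₀ flowR K h0]; exact mul_pos (by positivity) (pow_pos flowR_pos _)
  · exact one_pos

/-- `ρ_j > 0`. [cite: BenfattoGiulianiMastropietro2006, §2.8 (2.85)] -/
theorem flowRho_pos (hA : 0 < A) (hκ₀ : 0 < κ₀) (hβ : 0 < β) (j : ℕ) : 0 < flowRho A κ₀ β Λ₀ K j := by
  unfold flowRho; split_ifs
  · exact mul_pos flowSqr_pos (flowKap_pos hA hκ₀ hβ 1)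
  · exact flowKap_pos hA hκ₀ hβ j

/-- `t_j > 0`. [cite: BenfattoGiulianiMastropietro2006, §2.8 (2.85)] -/
theorem flowT_pos (hA : 0 < A) (hκ₀ : 0 < κ₀) (hβ : 0 < β) (j : ℕ) : 0 < flowT A κ₀ β Λ₀ K j := by
  unfold flowT; split_ifs
  · exact div_pos flowX_pos (mul_pos (Real.exp_pos 2) (add_pos (flowKap_pos hA hκ₀ hβ 0) (flowRho_pos hA hκ₀ hβ 0)))
  · exact inv_pos.2 (flowRho_pos hA hκ₀ hβ _)

/-- `t_{j+1} = 1/ρ_j`. [cite: BenfattoGiulianiMastropietro2006, §2.8 (2.85)] -/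
theorem flowT_succ (j : ℕ) : flowT A κ₀ β Λ₀ K (j + 1) = (flowRho A κ₀ β Λ₀ K j)⁻¹ := by
  simp [flowT]

/-- `κ_j² = A Λ_j` for `1 ≤ j ≤ K` (`A ≥ 0`, `β > 0`). [cite: BenfattoGiulianiMastropietro2006, §2.8 (2.80)] -/
theorem flowKap_sq (hA : 0 ≤ A) (hβ : 0 < β) {j : ℕ} (hj : j ≠ 0) (hjK : j ≤ K) :
    flowKap A κ₀ β Λ₀ K j ^ 2 = A * gridScale β Λ₀ flowR K j := by
  unfold flowKap
  rw [if_neg hj, if_pos hjK, Real.sq_sqrt]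
  rw [gridScale_of_ne_zero β Λ₀ flowR K hj]
  exact mul_nonneg hA (mul_nonneg (by positivity) (pow_nonneg flowR_pos.le _))

/-- The scales are geometric: `Λ_{j-1} = r Λ_j` for `2 ≤ j ≤ K`. [cite: BenfattoGiulianiMastropietro2006, §2.2 (2.9)] -/
theorem gridScale_pred (β Λ₀ : ℝ) {K j : ℕ} (hj : 2 ≤ j) (hjK : j ≤ K) :
    gridScale β Λ₀ flowR K (j - 1) = flowR * gridScale β Λ₀ flowR K j := by
  rw [gridScale_of_ne_zero β Λ₀ flowR K (show j - 1 ≠ 0 by omega), gridScale_of_ne_zero β Λ₀ flowR K (show j ≠ 0 by omega),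
    show K - (j - 1) = (K - j) + 1 by omega, pow_succ]
  ring

/-- `Λ_j ≥ π/β` for `1 ≤ j` (`β > 0`). [cite: BenfattoGiulianiMastropietro2006, §2.2 (2.9)] -/
theorem pi_div_le_gridScale {β : ℝ} (hβ : 0 < β) (Λ₀ : ℝ) (K : ℕ) {j : ℕ} (hj : j ≠ 0) :
    Real.pi / β ≤ gridScale β Λ₀ flowR K j := by
  rw [gridScale_of_ne_zero β Λ₀ flowR K hj]
  exact le_mul_of_one_le_right (by positivity) (one_le_pow₀ (by linarith [two_le_flowR]))

/-- **`x_j = e²(κ_j + ρ_j) t_j = x̄` at every scale `j ≤ K`** (the choice of `ρ_0` and of the ratio). [cite: BenfattoGiulianiMastropietro2006, §2.8 (2.85)] -/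
theorem flow_x_eq (hA : 0 < A) (hκ₀ : 0 < κ₀) (hβ : 0 < β) {j : ℕ} (hjK : j ≤ K) :
    Real.exp 2 * (flowKap A κ₀ β Λ₀ K j + flowRho A κ₀ β Λ₀ K j) * flowT A κ₀ β Λ₀ K j = flowX := by
  rcases Nat.eq_zero_or_pos j with rfl | hj
  · have h := add_pos (flowKap_pos (K := K) (Λ₀ := Λ₀) hA hκ₀ hβ 0) (flowRho_pos (K := K) (Λ₀ := Λ₀) hA hκ₀ hβ 0)
    simp only [flowT, if_true]
    field_simp
  · have hj0 : j ≠ 0 := by omega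
    rw [flowX_eq]
    simp only [flowT, flowRho, if_neg hj0]
    rcases Nat.eq_or_lt_of_le hj with h1 | h2
    · -- `j = 1`: `ρ_0 = √r κ_1`
      subst h1
      simp only [Nat.sub_self, if_true]
      have hk := flowKap_pos (K := K) (Λ₀ := Λ₀) hA hκ₀ hβ 1
      have hs := flowSqr_pos
      field_simp
      norm_num
    · -- `2 ≤ j ≤ K`: `κ_{j-1} = √r κ_j`
      have hjm : j - 1 ≠ 0 := by omega
      rw [if_neg hjm]
      have hkj : flowKap A κ₀ β Λ₀ K (j - 1) = flowSqr * flowKap A κ₀ β Λ₀ K j := by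
        unfold flowKap
        rw [if_neg hjm, if_pos (by omega), if_neg hj0, if_pos hjK, gridScale_pred β Λ₀ (by omega) hjK, ← mul_assoc,
          mul_comm A flowR, mul_assoc, Real.sqrt_mul flowR_pos.le, sqrt_flowR]
      rw [hkj]
      have hk := flowKap_pos (K := K) (Λ₀ := Λ₀) hA hκ₀ hβ j
      have hs := flowSqr_pos
      field_simp
      ring

end Sequences

/-! ### The tracked couplings and the size of the tracked part -/

section Tracked

variable {L M N : ℕ} [NeZero L] [NeZero N]

variable (L M N) in
/-- **The tracked quadratic couplings** `ν_j = ν₀ + u Σ_{i<j} t_i`. [cite: BenfattoGiulianiMastropietro2006, §2.8 (2.86)] -/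
def flowNu (β μR θ Λ₀ : ℝ) (K : ℕ) (u ν₀ : ℂ) (j : ℕ) : ℂ :=
  ν₀ + u * ∑ i ∈ range j, gridScaleTadpole L M β μR θ Λ₀ flowR K i

/-- `ν_{j+1} = ν_j + u t_j`. [cite: BenfattoGiulianiMastropietro2006, §2.8 (2.86)] -/
theorem flowNu_succ (β μR θ Λ₀ : ℝ) (K : ℕ) (u ν₀ : ℂ) (j : ℕ) :
    flowNu L M β μR θ Λ₀ K u ν₀ (j + 1) = flowNu L M β μR θ Λ₀ K u ν₀ j + u * gridScaleTadpole L M β μR θ Λ₀ flowR K j := by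
  simp only [flowNu, sum_range_succ]; ring

/-- `ν_0 = ν₀`. [cite: BenfattoGiulianiMastropietro2006, §2.8 (2.86)] -/
@[simp] theorem flowNu_zero (β μR θ Λ₀ : ℝ) (K : ℕ) (u ν₀ : ℂ) : flowNu L M β μR θ Λ₀ K u ν₀ 0 = ν₀ := by simp [flowNu]

omit [NeZero N] in
/-- **The field-weighted size of the tracked part in closed form**: `‖L_j‖_h = (e²(κ+ρ))² |ν| β/N + (e²(κ+ρ))⁴ |u| β/N`
(`4 ≤ #Γ`). [cite: BenfattoGiulianiMastropietro2006, §2.8 (2.86)-(2.88)] -/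
theorem normV_gridTrackedNL (hcard : 4 ≤ Fintype.card (GridLeg (GridPoint L N))) (κ ρ β : ℝ) (u ν : ℂ) :
    normV (GridLeg (GridPoint L N)) κ ρ (fun m' => gridTrackedNL N β u ν (2 * m')) =
      (Real.exp 2 * (κ + ρ)) ^ 2 * (‖ν‖ * (β / N)) + (Real.exp 2 * (κ + ρ)) ^ 4 * (‖u‖ * (β / N)) := by
  unfold normV
  have h1 : 1 ∈ range (Fintype.card (GridLeg (GridPoint L N)) / 2 + 1) := mem_range.2 (by omega)
  have h2 : 2 ∈ range (Fintype.card (GridLeg (GridPoint L N)) / 2 + 1) := mem_range.2 (by omega)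
  rw [Finset.sum_eq_add_of_mem 1 2 h1 h2 (by norm_num)]
  · simp [gridTrackedNL]
  · intro m hm hne
    have : gridTrackedNL N β u ν (2 * m) = 0 := by
      unfold gridTrackedNL
      rw [if_neg (by omega), if_neg (by omega)]
    simp only [this, mul_zero]

/-- The grid has at least four legs (`N, L ≥ 1`). [cite: BenfattoGiulianiMastropietro2006, §2.8 (2.86)] -/
theorem four_le_card_gridLeg : 4 ≤ Fintype.card (GridLeg (GridPoint L N)) := by
  have hN := Nat.pos_of_ne_zero (NeZero.ne N)
  have hL := Nat.pos_of_ne_zero (NeZero.ne L)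
  simp only [Fintype.card_prod, Fintype.card_fin, Fintype.card_fun, ZMod.card]
  have : 1 ≤ N * L ^ 2 := Nat.one_le_iff_ne_zero.2 (by positivity)
  nlinarith

/-- **The scale tadpoles are bounded by the squared Gram constants**: `‖t_j‖ ≤ Σ_k (βL²)⁻² ‖symbol_j(k)‖`, which for a slice is the
squared norm of a grid Gram vector. [cite: BenfattoGiulianiMastropietro2006, §2.8 (2.80)] -/
theorem norm_gridScaleTadpole_le (β μR θ Λ₀ r : ℝ) (K j : ℕ) :
    ‖gridScaleTadpole L M β μR θ Λ₀ r K j‖ ≤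
      ∑ k : FreqMomentum L M, ‖((1 / (β * (L : ℝ) ^ 2) : ℝ) : ℂ)‖ ^ 2 * ‖gridScaleSymbol L M β μR θ Λ₀ r K j (k, 0)‖ := by
  unfold gridScaleTadpole
  rw [norm_neg]
  refine (norm_sum_le _ _).trans (le_of_eq (sum_congr rfl fun k _ => ?_))
  rw [norm_mul, norm_pow]

/-- **`‖t_j‖ ≤ κ_j²`-type bound for the slices**: for `1 ≤ j ≤ K` with `0 < Λ_j ≤ Λ_{j-1} ≤ d₀/2`, `|θ| ≤ π/(4β)`,
`‖t_j‖ ≤ (βL²)⁻²(Λ′β/π+3)·4L(Λ′L/c_{d₀}+1)·(8/3)βL²/Λ`. [cite: BenfattoGiulianiMastropietro2006, §2.8 (2.80)] -/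
theorem norm_gridScaleTadpole_slice_le {β : ℝ} (hβ : 0 < β) {μ d₀ : ℝ} (hμ4 : d₀ ≤ μ + 4) (hμ0 : d₀ ≤ -μ) {θ : ℝ}
    (hθ : |θ| ≤ Real.pi / (4 * β)) (Λ₀ r : ℝ) {K j : ℕ} (hj : j ≠ 0) (hjK : j ≤ K)
    (hΛ : 0 < gridScale β Λ₀ r K j) (hΛΛ' : gridScale β Λ₀ r K j ≤ gridScale β Λ₀ r K (j - 1))
    (hΛ'd : gridScale β Λ₀ r K (j - 1) ≤ d₀ / 2) :
    ‖gridScaleTadpole L M β μ θ Λ₀ r K j‖ ≤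
      ‖((1 / (β * (L : ℝ) ^ 2) : ℝ) : ℂ)‖ ^ 2 *
        (((gridScale β Λ₀ r K (j - 1) * β / Real.pi + 3) *
          (4 * (L * (gridScale β Λ₀ r K (j - 1) * L / (2 * Real.pi * Real.sqrt (d₀ / 8)) + 1)))) *
          (8 / 3 * (β * (L : ℝ) ^ 2) / gridScale β Λ₀ r K j)) := by
  refine (norm_gridScaleTadpole_le β μ θ Λ₀ r K j).trans ?_
  have hsym : ∀ k : FreqMomentum L M, gridScaleSymbol L M β μ θ Λ₀ r K j (k, 0) =
      shiftedSliceSymbol L M β μ θ (gridScale β Λ₀ r K j) (gridScale β Λ₀ r K (j - 1)) (k, 0) := by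
    intro k; simp [gridScaleSymbol, hj, hjK]
  simp_rw [hsym]
  have h := norm_sq_gridGramF_shiftedSlice_le (L := L) (M := M) (P := Unit) hβ hμ4 hμ0 hθ hΛ hΛΛ' hΛ'd (fun _ => (0 : TorusSite 2 L))
    (fun _ => (0 : ℝ)) ((((), (0 : Fin 2)), (0 : Fin 2)) : GridLeg Unit)
  rw [norm_sq_gridGramF] at h
  exact h

end Tracked

/-! ### Scale inequalities -/

/-- `Λ_j ≤ Λ_1` for `1 ≤ j` (`β > 0`). [cite: BenfattoGiulianiMastropietro2006, §2.2 (2.9)] -/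
theorem gridScale_le_one' {β : ℝ} (hβ : 0 < β) (Λ₀ : ℝ) {K j : ℕ} (hj : j ≠ 0) :
    gridScale β Λ₀ flowR K j ≤ gridScale β Λ₀ flowR K 1 := by
  rw [gridScale_of_ne_zero β Λ₀ flowR K hj, gridScale_of_ne_zero β Λ₀ flowR K one_ne_zero]
  exact mul_le_mul_of_nonneg_left (pow_le_pow_right₀ (by linarith [two_le_flowR]) (by omega)) (by positivity)

/-- `Λ_j ≤ Λ_{j-1} ≤ r Λ_j` for `1 ≤ j ≤ K`, given `Λ_1 ≤ Λ₀ ≤ r Λ_1` at the top. [cite: BenfattoGiulianiMastropietro2006, §2.2 (2.9)] -/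
theorem gridScale_pred_bounds {β : ℝ} (hβ : 0 < β) {Λ₀ : ℝ} {K : ℕ} (hK1 : gridScale β Λ₀ flowR K 1 ≤ Λ₀)
    (hK2 : Λ₀ ≤ flowR * gridScale β Λ₀ flowR K 1) {j : ℕ} (hj : j ≠ 0) (hjK : j ≤ K) :
    gridScale β Λ₀ flowR K j ≤ gridScale β Λ₀ flowR K (j - 1) ∧
      gridScale β Λ₀ flowR K (j - 1) ≤ flowR * gridScale β Λ₀ flowR K j := by
  rcases Nat.lt_or_ge j 2 with h1 | h2
  · have : j = 1 := by omega
    subst this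
    simp only [Nat.sub_self, gridScale_zero]
    exact ⟨hK1, hK2⟩
  · rw [gridScale_pred β Λ₀ h2 hjK]
    refine ⟨le_mul_of_one_le_left ?_ (by linarith [two_le_flowR]), le_rfl⟩
    rw [gridScale_of_ne_zero β Λ₀ flowR K hj]; exact mul_nonneg (by positivity) (pow_nonneg flowR_pos.le _)

/-- **The slice Gram constant, simplified**: for `π/β ≤ Λ′`, `c_{d₀} ≤ Λ′L`, `0 < Λ`,
`(βL²)⁻²(Λ′β/π+3)·4L(Λ′L/c_{d₀}+1)·(8/3)βL²/Λ ≤ (256/(3π c_{d₀}))·Λ′²/Λ`. [cite: BenfattoGiulianiMastropietro2006, §2.8 (2.80)] -/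
theorem slice_gram_bound_le {β Λ Λ' d₀ : ℝ} {L : ℕ} (hβ : 0 < β) (hL : 0 < (L : ℝ)) (hd₀ : 0 < d₀) (hΛ : 0 < Λ)
    (hΛ'β : Real.pi / β ≤ Λ') (hcL : 2 * Real.pi * Real.sqrt (d₀ / 8) ≤ Λ' * L) :
    ‖((1 / (β * (L : ℝ) ^ 2) : ℝ) : ℂ)‖ ^ 2 *
        (((Λ' * β / Real.pi + 3) * (4 * (L * (Λ' * L / (2 * Real.pi * Real.sqrt (d₀ / 8)) + 1)))) * (8 / 3 * (β * (L : ℝ) ^ 2) / Λ)) ≤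
      256 / (3 * Real.pi * (2 * Real.pi * Real.sqrt (d₀ / 8))) * (Λ' ^ 2 / Λ) := by
  set cd : ℝ := 2 * Real.pi * Real.sqrt (d₀ / 8) with hcd
  have hcd0 : 0 < cd := by rw [hcd]; positivity
  have hΛ' : 0 < Λ' := lt_of_lt_of_le (by positivity) hΛ'β
  have hc : ‖((1 / (β * (L : ℝ) ^ 2) : ℝ) : ℂ)‖ ^ 2 = 1 / (β * (L : ℝ) ^ 2) ^ 2 := by
    rw [Complex.norm_real, Real.norm_eq_abs, abs_of_pos (by positivity)]; ring
  have hFw : Λ' * β / Real.pi + 3 ≤ 4 * (Λ' * β / Real.pi) := by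
    have hx : 1 ≤ Λ' * β / Real.pi := by
      rw [one_le_div Real.pi_pos]; have := (div_le_iff₀ hβ).1 hΛ'β; linarith
    linarith only [hx]
  have hSh : (L : ℝ) * (Λ' * L / cd + 1) ≤ L * (2 * (Λ' * L / cd)) := by
    have hx : 1 ≤ Λ' * L / cd := by rw [one_le_div hcd0]; exact hcL
    exact mul_le_mul_of_nonneg_left (by linarith only [hx]) hL.le
  rw [hc]
  calc 1 / (β * (L : ℝ) ^ 2) ^ 2 * ((Λ' * β / Real.pi + 3) * (4 * (L * (Λ' * L / cd + 1))) * (8 / 3 * (β * (L : ℝ) ^ 2) / Λ))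
      ≤ 1 / (β * (L : ℝ) ^ 2) ^ 2 * ((4 * (Λ' * β / Real.pi)) * (4 * (L * (2 * (Λ' * L / cd)))) * (8 / 3 * (β * (L : ℝ) ^ 2) / Λ)) := by
        gcongr
    _ = 256 / (3 * Real.pi * cd) * (Λ' ^ 2 / Λ) := by field_simp; ring

/-! ### The tracked couplings: bounds -/

section TrackedBounds

variable {L M N : ℕ} [NeZero L] [NeZero N]

/-- The slice tadpoles are `≤ A Λ_j`, `A = 256 r²/(3π c_{d₀})`, for `1 ≤ j ≤ K` under the standing hypotheses.
[cite: BenfattoGiulianiMastropietro2006, §2.8 (2.80)] -/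
theorem norm_gridScaleTadpole_le_A {β : ℝ} (hβ : 0 < β) {μ d₀ : ℝ} (hd₀ : 0 < d₀) (hμ4 : d₀ ≤ μ + 4) (hμ0 : d₀ ≤ -μ) {θ : ℝ}
    (hθ : |θ| ≤ Real.pi / (4 * β)) {Λ₀ : ℝ} (hΛ₀d : Λ₀ ≤ d₀ / 2) {K : ℕ}
    (hK1 : gridScale β Λ₀ flowR K 1 ≤ Λ₀) (hK2 : Λ₀ ≤ flowR * gridScale β Λ₀ flowR K 1)
    (hL : 2 * Real.pi * Real.sqrt (d₀ / 8) ≤ Real.pi / β * L) {j : ℕ} (hj : j ≠ 0) (hjK : j ≤ K) :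
    ‖gridScaleTadpole L M β μ θ Λ₀ flowR K j‖ ≤
      256 * flowR ^ 2 / (3 * Real.pi * (2 * Real.pi * Real.sqrt (d₀ / 8))) * gridScale β Λ₀ flowR K j := by
  have hL0 : (0 : ℝ) < L := by exact_mod_cast Nat.pos_of_ne_zero (NeZero.ne L)
  obtain ⟨hΛΛ', hΛ'r⟩ := gridScale_pred_bounds hβ hK1 hK2 hj hjK
  have hΛ : 0 < gridScale β Λ₀ flowR K j := lt_of_lt_of_le (by positivity) (pi_div_le_gridScale hβ Λ₀ K hj)
  -- `Λ' = Λ_{j-1}`: `π/β ≤ Λ'`, `Λ' ≤ Λ₀ ≤ d₀/2`, `c_d ≤ Λ' L`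
  have hΛ'β : Real.pi / β ≤ gridScale β Λ₀ flowR K (j - 1) := (pi_div_le_gridScale hβ Λ₀ K hj).trans hΛΛ'
  have hΛ'0 : gridScale β Λ₀ flowR K (j - 1) ≤ Λ₀ := by
    rcases Nat.eq_zero_or_pos (j - 1) with h0 | hpos
    · rw [h0, gridScale_zero]
    · exact (gridScale_le_one' hβ Λ₀ (by omega)).trans hK1
  have hcL : 2 * Real.pi * Real.sqrt (d₀ / 8) ≤ gridScale β Λ₀ flowR K (j - 1) * L :=
    hL.trans (mul_le_mul_of_nonneg_right hΛ'β hL0.le)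
  refine (norm_gridScaleTadpole_slice_le hβ hμ4 hμ0 hθ Λ₀ flowR hj hjK hΛ hΛΛ' (hΛ'0.trans hΛ₀d)).trans ?_
  refine (slice_gram_bound_le hβ hL0 hd₀ hΛ hΛ'β hcL).trans ?_
  rw [show 256 * flowR ^ 2 / (3 * Real.pi * (2 * Real.pi * Real.sqrt (d₀ / 8))) * gridScale β Λ₀ flowR K j =
      256 / (3 * Real.pi * (2 * Real.pi * Real.sqrt (d₀ / 8))) * (flowR ^ 2 * gridScale β Λ₀ flowR K j) by ring]
  refine mul_le_mul_of_nonneg_left ?_ (by positivity)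
  rw [div_le_iff₀ hΛ]
  have hΛ'0' : 0 ≤ gridScale β Λ₀ flowR K (j - 1) := (lt_of_lt_of_le (by positivity) hΛ'β).le
  have := mul_le_mul hΛ'r hΛ'r hΛ'0' (mul_nonneg flowR_pos.le hΛ.le)
  nlinarith

/-- **The tail of the slice scales is geometric**: `Σ_{j ≤ i ≤ K} Λ_i ≤ 2 Λ_j` (`1 ≤ j`, `r ≥ 2`). [cite: BenfattoGiulianiMastropietro2006, §2.2 (2.9)] -/
theorem sum_gridScale_tail_le {β : ℝ} (hβ : 0 < β) (Λ₀ : ℝ) {K j : ℕ} (hj : j ≠ 0) (hjK : j ≤ K) :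
    ∑ i ∈ Finset.Icc j K, gridScale β Λ₀ flowR K i ≤ 2 * gridScale β Λ₀ flowR K j := by
  have hr := two_le_flowR
  -- reindex `i = K - m`, `m = 0..K-j`
  have hterm : ∀ i ∈ Finset.Icc j K, gridScale β Λ₀ flowR K i = Real.pi / β * flowR ^ (K - i) := fun i hi =>
    gridScale_of_ne_zero β Λ₀ flowR K (by have := (Finset.mem_Icc.1 hi).1; omega)
  rw [sum_congr rfl hterm, ← mul_sum, gridScale_of_ne_zero β Λ₀ flowR K hj, mul_left_comm]
  refine mul_le_mul_of_nonneg_left ?_ (by positivity)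
  -- `Σ_{i=j}^{K} r^{K-i} = Σ_{m=0}^{K-j} r^m ≤ 2 r^{K-j}`
  have hreindex : ∑ i ∈ Finset.Icc j K, flowR ^ (K - i) = ∑ m ∈ range (K - j + 1), flowR ^ m := by
    refine Finset.sum_nbij' (fun i => K - i) (fun m => K - m) ?_ ?_ ?_ ?_ ?_
    · intro i hi; have := Finset.mem_Icc.1 hi; exact mem_range.2 (by omega)
    · intro m hm; have := mem_range.1 hm; exact Finset.mem_Icc.2 ⟨by omega, by omega⟩
    · intro i hi; have := Finset.mem_Icc.1 hi; omega
    · intro m hm; have := mem_range.1 hm; omega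
    · intro i _; rfl
  rw [hreindex, geom_sum_eq (by linarith), div_le_iff₀ (by linarith)]
  have hpow : 0 < flowR ^ (K - j) := pow_pos flowR_pos _
  rw [pow_succ]
  nlinarith

/-- **The tracked quadratic couplings stay small**: with the residual hypothesis `‖ν₀ + u Σ_{i ≤ K} t_i‖ ≤ R` and
`‖t_i‖ ≤ A Λ_i` on the slices, `‖ν_j‖ ≤ R + ‖u‖ · 2A Λ_{j ∧ K}` for `1 ≤ j ≤ K + 1` (`K ≠ 0`). [cite: BenfattoGiulianiMastropietro2006, §2.8 (2.86)-(2.88)] -/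
theorem norm_flowNu_le {β : ℝ} (hβ : 0 < β) {μR θ Λ₀ : ℝ} {K : ℕ} (hK : K ≠ 0) {u ν₀ : ℂ} {R A : ℝ} (hA : 0 ≤ A)
    (hres : ‖ν₀ + u * ∑ i ∈ range (K + 1), gridScaleTadpole L M β μR θ Λ₀ flowR K i‖ ≤ R)
    (ht : ∀ i, i ≠ 0 → i ≤ K → ‖gridScaleTadpole L M β μR θ Λ₀ flowR K i‖ ≤ A * gridScale β Λ₀ flowR K i)
    {j : ℕ} (hj : j ≠ 0) (hjK : j ≤ K + 1) :
    ‖flowNu L M β μR θ Λ₀ K u ν₀ j‖ ≤ R + ‖u‖ * (2 * A * gridScale β Λ₀ flowR K (j ⊓ K)) := by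
  -- `ν_j = (ν₀ + u Σ_{i ≤ K} t_i) - u Σ_{j ≤ i ≤ K} t_i`
  have hsplit : flowNu L M β μR θ Λ₀ K u ν₀ j =
      (ν₀ + u * ∑ i ∈ range (K + 1), gridScaleTadpole L M β μR θ Λ₀ flowR K i) -
        u * ∑ i ∈ Finset.Ico j (K + 1), gridScaleTadpole L M β μR θ Λ₀ flowR K i := by
    rw [flowNu, ← Finset.sum_range_add_sum_Ico _ hjK]; ring
  rw [hsplit]
  refine (norm_sub_le _ _).trans (add_le_add hres ?_)
  rw [norm_mul]
  refine mul_le_mul_of_nonneg_left ?_ (norm_nonneg _)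
  refine (norm_sum_le _ _).trans ?_
  rcases Nat.lt_or_ge K j with hKj | hjK'
  · -- empty tail (`j = K + 1`)
    have : Finset.Ico j (K + 1) = ∅ := Finset.Ico_eq_empty (by omega)
    rw [this, sum_empty]
    have := pi_div_le_gridScale hβ Λ₀ K (show j ⊓ K ≠ 0 by rw [Nat.min_eq_right hKj.le]; exact hK)
    have : 0 ≤ gridScale β Λ₀ flowR K (j ⊓ K) := (lt_of_lt_of_le (by positivity) this).le
    positivity
  · rw [show j ⊓ K = j from Nat.min_eq_left hjK']
    have hIco : Finset.Ico j (K + 1) = Finset.Icc j K := by ext i; simp [Finset.mem_Ico, Finset.mem_Icc]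
    rw [hIco]
    calc ∑ i ∈ Finset.Icc j K, ‖gridScaleTadpole L M β μR θ Λ₀ flowR K i‖ ≤ ∑ i ∈ Finset.Icc j K, A * gridScale β Λ₀ flowR K i :=
          sum_le_sum fun i hi => ht i (by have := (Finset.mem_Icc.1 hi).1; omega) (Finset.mem_Icc.1 hi).2
      _ = A * ∑ i ∈ Finset.Icc j K, gridScale β Λ₀ flowR K i := by rw [mul_sum]
      _ ≤ A * (2 * gridScale β Λ₀ flowR K j) := mul_le_mul_of_nonneg_left (sum_gridScale_tail_le hβ Λ₀ hj hjK') hA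
      _ = 2 * A * gridScale β Λ₀ flowR K j := by ring

end TrackedBounds

end Literature.MathematicalPhysics.QuantumLattice

end
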